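import Literature.NumberTheory.DiophantineGeometry.PartitionTableaux
import Mathlib.Data.Int.Interval
import Mathlib.Algebra.BigOperators.Intervals
import Mathlib.Data.Real.Basic
import Mathlib.Tactic.Linarith
import Mathlib.Tactic.Ring
import Mathlib.Tactic.FieldSimp
import HarnessLib

/-!
# The boundary word of a Young diagram (Vershik–Kerov coordinates)

Topic `RepresentationTheory/FiniteGroups` (combinatorial input of the Vershik–Kerov bound
`VershikKerov1985_maxCharDegree`). For a Young diagram `Y` (rows `r`, columns `c`, both
`0`-indexed, `λ_r = Y.rowLen r`, `λ'_c = Y.colLen c`) drawn in the Russian convention, the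
boundary is a lattice path with unit steps of slope `±1`: the down-steps sit over the integer
intervals `[d_r, d_r + 1)` with `d_r = λ_r - r - 1` and the up-steps over `[u_c, u_c + 1)` with
`u_c = c - λ'_c`.  We prove the classical facts (Macdonald I (1.7); Vershik–Kerov §2):
the `d_r` are strictly decreasing, the `u_c` strictly increasing, `{d_r} ⊔ {u_c} = ℤ`
(`upPos_ne_downPos`, `exists_upPos_eq`), the box criterion `(r, c) ∈ Y ↔ u_c < d_r`, the hook
length of a box is `d_r - u_c`, and the two window sums of the slope word
`σ_m = -1 (m ∈ {d_r}), +1 (m ∈ {u_c})`: `Σ_{-M ≤ m < M} σ_m = 0` and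
`Σ_{-M ≤ m < M} σ_m (m + ½) = M² - 2|Y|` for `M ≥ max(λ_0, λ'_0)`.

## References

* A. M. Vershik, S. V. Kerov, *Asymptotic of the largest and the typical dimensions of
  irreducible representations of a symmetric group*, Funct. Anal. Appl. 19 (1985) 21–31.
  [VershikKerov1985]
* I. G. Macdonald, *Symmetric functions and Hall polynomials*, 2nd ed., Oxford 1995, I §1 (1.7).
* S. Mkrtchyan, arXiv:1008.3854, §3–§5. [Mkrtchyan2012]
* A. Aggarwal, D. Elboim, arXiv:2605.25995, Prop. 2.1. [AggarwalElboim2026]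

## Mathlib

`YoungDiagram.rowLen`, `YoungDiagram.colLen`, `mem_iff_lt_rowLen`, `mem_iff_lt_colLen`,
`rowLen_anti`, `colLen_anti`; tree: `YoungDiagram.sum_rowLens`, `hookLength`.
-/

namespace Literature.RepresentationTheory.FiniteGroups

open Finset YoungDiagram
open Literature.NumberTheory.DiophantineGeometry (hookLength)

namespace VershikKerov

variable (Y : YoungDiagram)

/-- Down-step position of row `r`: `d_r = λ_r - r - 1`. [cite: VershikKerov1985, §2] -/
def downPos (r : ℕ) : ℤ := (Y.rowLen r : ℤ) - r - 1

/-- Up-step position of column `c`: `u_c = c - λ'_c`. [cite: VershikKerov1985, §2] -/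
def upPos (c : ℕ) : ℤ := (c : ℤ) - Y.colLen c

/-- `m` is a down-step position of the boundary of `Y`. [cite: VershikKerov1985, §2] -/
def IsDown (m : ℤ) : Prop := ∃ r : ℕ, downPos Y r = m

/-- `d_r` is strictly decreasing. [folklore] -/
theorem downPos_strictAnti : StrictAnti (downPos Y) := by
  intro r r' h
  simp only [downPos]
  have := Y.rowLen_anti r r' h.le
  omega

/-- `u_c` is strictly increasing. [folklore] -/
theorem upPos_strictMono : StrictMono (upPos Y) := by
  intro c c' h
  simp only [upPos]
  have := Y.colLen_anti c c' h.le
  omega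

/-- Box criterion: `(r, c) ∈ Y ↔ u_c < d_r`. [folklore] -/
theorem mem_iff_upPos_lt_downPos {r c : ℕ} : (r, c) ∈ Y ↔ upPos Y c < downPos Y r := by
  constructor
  · intro h
    have h1 := mem_iff_lt_rowLen.mp h
    have h2 := mem_iff_lt_colLen.mp h
    simp only [upPos, downPos]
    omega
  · intro h
    by_contra hn
    have h1 : ¬c < Y.rowLen r := fun h' => hn (mem_iff_lt_rowLen.mpr h')
    have h2 : ¬r < Y.colLen c := fun h' => hn (mem_iff_lt_colLen.mpr h')
    simp only [upPos, downPos] at h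
    omega

/-- Up- and down-step positions are disjoint. [folklore] -/
theorem upPos_ne_downPos (r c : ℕ) : upPos Y c ≠ downPos Y r := by
  by_cases h : (r, c) ∈ Y
  · exact ((mem_iff_upPos_lt_downPos Y).mp h).ne
  · intro he
    have h1 : ¬c < Y.rowLen r := fun h' => h (mem_iff_lt_rowLen.mpr h')
    have h2 : ¬r < Y.colLen c := fun h' => h (mem_iff_lt_colLen.mpr h')
    simp only [upPos, downPos] at he
    omega

/-- An up-step position is not a down-step position. [folklore] -/
theorem not_isDown_upPos (c : ℕ) : ¬IsDown Y (upPos Y c) := fun ⟨r, hr⟩ =>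
  upPos_ne_downPos Y r c hr.symm

/-- For a box, the hook length is `d_r - u_c`. [folklore] -/
theorem hookLength_eq_downPos_sub_upPos {r c : ℕ} (h : (r, c) ∈ Y) :
    (hookLength Y (r, c) : ℤ) = downPos Y r - upPos Y c := by
  have h1 := mem_iff_lt_rowLen.mp h
  have h2 := mem_iff_lt_colLen.mp h
  simp only [hookLength, upPos, downPos]
  omega

/-- Rows below the first column are empty: `λ_r = 0` for `r ≥ λ'_0`. [folklore] -/
theorem rowLen_eq_zero {r : ℕ} (hr : Y.colLen 0 ≤ r) : Y.rowLen r = 0 := by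
  by_contra h
  have h' : (r, 0) ∈ Y := mem_iff_lt_rowLen.mpr (Nat.pos_of_ne_zero h)
  exact absurd (mem_iff_lt_colLen.mp h') (not_lt.mpr hr)

/-- `d_r = -r - 1` for `r ≥ λ'_0`. [folklore] -/
theorem downPos_of_colLen_le {r : ℕ} (hr : Y.colLen 0 ≤ r) : downPos Y r = -r - 1 := by
  simp [downPos, rowLen_eq_zero Y hr]

/-- `d_r ≤ λ_0 - 1 - r`. [folklore] -/
theorem downPos_le (r : ℕ) : downPos Y r ≤ Y.rowLen 0 - 1 - r := by
  simp only [downPos]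
  have := Y.rowLen_anti 0 r r.zero_le
  omega

/-- `-r - 1 ≤ d_r`. [folklore] -/
theorem neg_le_downPos (r : ℕ) : -(r : ℤ) - 1 ≤ downPos Y r := by
  simp only [downPos]; omega

/-- Every integer `≤ -λ'_0 - 1` is a down-step position. [folklore] -/
theorem isDown_of_le {m : ℤ} (hm : m ≤ -(Y.colLen 0 : ℤ) - 1) : IsDown Y m := by
  refine ⟨(-m - 1).toNat, ?_⟩
  have h0 : 0 ≤ -m - 1 := by omega
  rw [downPos_of_colLen_le Y (by omega), Int.toNat_of_nonneg h0]
  ring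

/-- No integer `≥ λ_0` is a down-step position. [folklore] -/
theorem not_isDown_of_le {m : ℤ} (hm : (Y.rowLen 0 : ℤ) ≤ m) : ¬IsDown Y m := by
  rintro ⟨r, hr⟩
  have := downPos_le Y r
  omega

/-- **Complementarity** (Macdonald I (1.7)): an integer that is not a down-step position is an
up-step position. [folklore] -/
theorem exists_upPos_eq {m : ℤ} (h : ¬IsDown Y m) : ∃ c, upPos Y c = m := by
  have hne : ∀ r, downPos Y r ≠ m := fun r hr => h ⟨r, hr⟩
  have hex : ∃ r : ℕ, downPos Y r < m := by
    refine ⟨(Y.rowLen 0 - m).toNat, ?_⟩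
    have h1 := downPos_le Y (Y.rowLen 0 - m).toNat
    have h2 := Int.self_le_toNat (Y.rowLen 0 - m)
    omega
  classical
  set r₀ := Nat.find hex with hr₀
  have hP : downPos Y r₀ < m := Nat.find_spec hex
  have hlt : ∀ r < r₀, m < downPos Y r := fun r hr =>
    lt_of_le_of_ne (not_lt.mp (Nat.find_min hex hr)) (hne r).symm
  have hc0 : 0 ≤ m + r₀ := by
    have := neg_le_downPos Y r₀
    omega
  refine ⟨(m + r₀).toNat, ?_⟩
  have hcast : (((m + r₀).toNat : ℕ) : ℤ) = m + r₀ := Int.toNat_of_nonneg hc0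
  -- `(r₀, c) ∉ Y`
  have hout : ¬r₀ < Y.colLen (m + r₀).toNat := by
    intro h'
    have h'' : (m + r₀).toNat < Y.rowLen r₀ := mem_iff_lt_rowLen.mp (mem_iff_lt_colLen.mpr h')
    simp only [downPos] at hP
    omega
  -- `(r₀ - 1, c) ∈ Y` when `r₀ ≥ 1`
  have hin : ∀ r, r + 1 = r₀ → r < Y.colLen (m + r₀).toNat := by
    intro r hr
    apply mem_iff_lt_colLen.mp
    apply mem_iff_lt_rowLen.mpr
    have := hlt r (by omega)
    simp only [downPos] at this
    omega
  simp only [upPos, hcast]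
  rcases Nat.eq_zero_or_pos r₀ with h0 | h0
  · rw [h0] at hout ⊢
    omega
  · have := hin (r₀ - 1) (by omega)
    omega

/-- Dichotomy: every integer is a down-step or an up-step position. [folklore] -/
theorem isDown_or_exists_upPos (m : ℤ) : IsDown Y m ∨ ∃ c, upPos Y c = m := by
  by_cases h : IsDown Y m
  · exact Or.inl h
  · exact Or.inr (exists_upPos_eq Y h)

/-- `λ_0 ≤ |Y|`. [folklore] -/
theorem rowLen_zero_le_card : Y.rowLen 0 ≤ Y.cells.card := by
  rw [Y.rowLen_eq_card]
  exact card_le_card (filter_subset _ _)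

/-- `λ'_0 ≤ |Y|`. [folklore] -/
theorem colLen_zero_le_card : Y.colLen 0 ≤ Y.cells.card := by
  rw [Y.colLen_eq_card]
  exact card_le_card (filter_subset _ _)

/-- `∑_{r < M} λ_r = |Y|` for `M ≥ λ'_0`. [folklore] -/
theorem sum_rowLen_eq_card {M : ℕ} (hM : Y.colLen 0 ≤ M) :
    ∑ r ∈ range M, Y.rowLen r = Y.cells.card := by
  have key : ∀ n, ∑ r ∈ range n, Y.rowLen r = ((List.range n).map Y.rowLen).sum := by
    intro n
    induction n with
    | zero => simp
    | succ n ih => rw [sum_range_succ, List.range_succ, List.map_append, List.sum_append, ih]; simp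
  have h1 : ∑ r ∈ range M, Y.rowLen r = ∑ r ∈ range (Y.colLen 0), Y.rowLen r := by
    rw [← sum_range_add_sum_Ico _ hM]
    rw [sum_eq_zero (s := Ico (Y.colLen 0) M) fun r hr => rowLen_eq_zero Y (mem_Ico.mp hr).1]
    simp
  rw [h1, key, ← Y.sum_rowLens]
  rfl

/-- The boxes of `Y` inside the `λ'_0 × λ_0` rectangle. [folklore] -/
theorem cells_eq_filter :
    Y.cells = (range (Y.colLen 0) ×ˢ range (Y.rowLen 0)).filter (fun rc => rc ∈ Y) := by
  ext ⟨r, c⟩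
  simp only [mem_filter, mem_product, mem_range, YoungDiagram.mem_cells, iff_and_self]
  intro h
  exact ⟨(mem_iff_lt_colLen.mp h).trans_le (Y.colLen_anti 0 c c.zero_le),
    (mem_iff_lt_rowLen.mp h).trans_le (Y.rowLen_anti 0 r r.zero_le)⟩

/-- The down-step positions in the window `[-M, M)` are exactly `d_0, …, d_{M-1}` when
`M ≥ max(λ_0, λ'_0)`. [folklore] -/
theorem filter_isDown_Ico [DecidablePred (IsDown Y)] {M : ℕ} (hR : Y.rowLen 0 ≤ M)
    (hC : Y.colLen 0 ≤ M) :
    (Ico (-(M : ℤ)) M).filter (IsDown Y) = (range M).image (downPos Y) := by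
  ext m
  simp only [mem_filter, mem_Ico, mem_image, mem_range]
  constructor
  · rintro ⟨⟨h1, _⟩, r, hr⟩
    refine ⟨r, ?_, hr⟩
    by_contra hrM
    have := downPos_of_colLen_le Y (le_trans hC (not_lt.mp hrM))
    omega
  · rintro ⟨r, hr, rfl⟩
    refine ⟨⟨?_, ?_⟩, r, rfl⟩
    · have := neg_le_downPos Y r; omega
    · have := downPos_le Y r; omega

/-- Window sum of the slope word: as many up-steps as down-steps in `[-M, M)`. [folklore] -/
theorem sum_Ico_ite_isDown [DecidablePred (IsDown Y)] {M : ℕ} (hR : Y.rowLen 0 ≤ M)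
    (hC : Y.colLen 0 ≤ M) :
    ∑ m ∈ Ico (-(M : ℤ)) M, (if IsDown Y m then (-1 : ℝ) else 1) = 0 := by
  have h1 : ∀ m : ℤ, (if IsDown Y m then (-1 : ℝ) else 1) = 1 - 2 * (if IsDown Y m then 1 else 0) := by
    intro m; split_ifs <;> norm_num
  simp_rw [h1]
  rw [sum_sub_distrib, ← mul_sum, ← sum_filter, filter_isDown_Ico Y hR hC, sum_const, sum_const,
    card_image_of_injective _ (downPos_strictAnti Y).injective, card_range, Int.card_Ico]
  simp only [nsmul_eq_mul, mul_one]
  have : (M : ℤ) - -(M : ℤ) = (2 * M : ℕ) := by push_cast; ring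
  rw [this, Int.toNat_natCast]
  push_cast; ring

/-- `∑_{m=-n}^{n-1} (m + ½) = 0`. [folklore] -/
theorem sum_Ico_add_half (n : ℕ) : ∑ m ∈ Ico (-(n : ℤ)) n, ((m : ℝ) + 1 / 2) = 0 := by
  induction n with
  | zero => simp
  | succ n ih =>
    have hsplit : Ico (-((n + 1 : ℕ) : ℤ)) ((n + 1 : ℕ) : ℤ) =
        insert (-((n : ℤ) + 1)) (insert (n : ℤ) (Ico (-(n : ℤ)) n)) := by
      ext m; simp only [mem_Ico, mem_insert]; push_cast; omega
    rw [hsplit, sum_insert, sum_insert, ih]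
    · push_cast; ring
    all_goals simp only [mem_insert, mem_Ico]; omega

/-- `∑_{r<n} (r + ½) = n²/2`. [folklore] -/
theorem sum_range_add_half (n : ℕ) : ∑ r ∈ range n, ((r : ℝ) + 1 / 2) = (n : ℝ) ^ 2 / 2 := by
  induction n with
  | zero => simp
  | succ n ih => rw [sum_range_succ, ih]; push_cast; ring

/-- First moment of the slope word over the window: `∑ σ_m (m + ½) = M² - 2|Y|`. [folklore] -/
theorem sum_Ico_ite_isDown_mul [DecidablePred (IsDown Y)] {M : ℕ} (hR : Y.rowLen 0 ≤ M)
    (hC : Y.colLen 0 ≤ M) :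
    ∑ m ∈ Ico (-(M : ℤ)) M, (if IsDown Y m then (-1 : ℝ) else 1) * ((m : ℝ) + 1 / 2) =
      (M : ℝ) ^ 2 - 2 * Y.cells.card := by
  have h1 : ∀ m : ℤ, (if IsDown Y m then (-1 : ℝ) else 1) * ((m : ℝ) + 1 / 2) =
      ((m : ℝ) + 1 / 2) - 2 * (if IsDown Y m then ((m : ℝ) + 1 / 2) else 0) := by
    intro m; split_ifs <;> ring
  simp_rw [h1]
  rw [sum_sub_distrib, ← mul_sum, ← sum_filter, filter_isDown_Ico Y hR hC,
    sum_image fun r _ r' _ h => (downPos_strictAnti Y).injective h, sum_Ico_add_half]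
  -- `∑_{r<M} (d_r + ½) = |Y| - M²/2`
  have hdown : ∑ r ∈ range M, ((downPos Y r : ℝ) + 1 / 2) = Y.cells.card - (M : ℝ) ^ 2 / 2 := by
    have h2 : ∀ r : ℕ, ((downPos Y r : ℝ) + 1 / 2) = (Y.rowLen r : ℝ) - ((r : ℝ) + 1 / 2) := by
      intro r; simp only [downPos]; push_cast; ring
    simp_rw [h2]
    rw [sum_sub_distrib, ← Nat.cast_sum, sum_rowLen_eq_card Y hC, sum_range_add_half]
  rw [hdown]
  ring

end VershikKerov


end Literature.RepresentationTheory.FiniteGroups
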